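import Summits.Ventures.LatticeQCDFlow.Scaling.ReplicaExchangeFiniteSampler

/-!
HONEST FRAMING: exact (Metropolis-corrected) sampling algorithms for lattice gauge theory; figures
of merit are autocorrelation/cost numbers at stated couplings and volumes; no continuum-physics
claim.

# ReplicaExchangeBareSampler — THE TAGLESS REPLICA-EXCHANGE SAMPLER ON A FINITE CONFIGURATION SPACE: STATE = THE
# REPLICA CONFIGURATIONS BY LEVEL `x : Fin (K+1) → S`, TARGET = THE PRODUCT LAW `Π_k μ_k(x_k)`, ONE STEP = A
# METROPOLIS SWAP OF A UNIFORM ADJACENT PAIR (prob. `t`) OR AN UPDATE OF A UNIFORM REPLICA (prob. `1 − t`); ROW-STOCHASTIC,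
# DETAILED BALANCE, AND THE TWO FLOW FORMULAS (lean-2 GEN-18, ours)

Venture-side (OURS).  Cell `lqcd-flow` (pub-lqcd), unit `pub-lqcd-lean-2-g18`, 2026-08-25.  Companion of
`Scaling/ReplicaExchangeFiniteSampler` (GEN-16), which carries a TAG (the level of one marked replica) in the state
for the round-trip analysis of PTBC.  For the "modes as blocks" decomposition (chapter R: `Scaling/ReplicaExchange
BareModeBlocks`, `…ModeGap`) the tag is bookkeeping that does not influence the configurations, and the natural
object is the sampler practitioners run: the chain on `Fin (K+1) → S` itself.  Objects (defs, mirrored on the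
tagged file): `ptBareProposal` (a uniformly chosen adjacent pair `(j, j+1)` proposes `x ∘ levelSwap j`),
`ptBareSwap μ = mhKernel ptBareProposal (tensorFun μ)` (accept w.p. `min{1, π̃(x∘σ_j)/π̃(x)}`),
`ptBareSampler t μ M = t·ptBareSwap μ + (1 − t)·prodKernel (1/(K+1)) M` (the tree's product chain of the replica
updates `M_k` with uniform weights).

## What is proved

* §1 the proposal is symmetric, non-negative, of row mass `≤ 1`, and gives each adjacent transposition weight
  `≥ 1/K`; `ptBareSwap`, `ptBareSampler` are ROW-STOCHASTIC and in DETAILED BALANCE with `tensorFun μ`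
  (`0 ≤ t ≤ 1`, `μ_k > 0`, `M_k` row-stochastic and `μ_k`-reversible).
* §2 the two flow formulas used by the decomposition: **`tensorFun_mul_ptBareSampler_swap_ge`** —
  `π̃(x)·P(x, x∘σ_j) ≥ (t/K)·min{π̃(x), π̃(x∘σ_j)}`; **`ptBareSampler_update`** — for `y ≠ x` agreeing with `x` off
  level `k`, `P(x, y) ≥ ((1 − t)/(K+1))·M_k(x_k, y_k)` (with equality unless `y` is also a swap image).

NOT CLAIMED: anything about mixing (chapter R files); general configuration spaces (`Scaling/ParallelTempering*`
give the kernels there); the lumping of the tagged sampler onto this one.  Literature grade (cell rule): TEXTBOOK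
ALGORITHM (Swendsen–Wang 1986, Geyer 1991, Hukushima–Nemoto 1996; the Literature's `ReplicaExchange` types the
Boltzmann case), NEW TYPING (arbitrary positive level laws, finite-chain vocabulary); nothing cited as a fact; no
new bib keys.
-/

noncomputable section

open Finset Function
open Literature.Probability.MarkovChains

namespace Summit.Ventures.LatticeQCDFlow.Scaling

variable {S : Type*} [Fintype S] [DecidableEq S] {K : ℕ}

/-! ## §1 The proposal, the swap move, the sampler -/

/-- The swap proposal on replica configurations: a uniformly chosen adjacent pair of levels is exchanged. [ours] -/
def ptBareProposal (x y : Fin (K + 1) → S) : ℝ :=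
  ∑ j : Fin K, if y = x ∘ levelSwap j then (1 : ℝ) / K else 0

omit [Fintype S] [DecidableEq S] in
/-- Exchanging twice is the identity. [ours] -/
theorem comp_levelSwap_levelSwap (j : Fin K) (x : Fin (K + 1) → S) : (x ∘ levelSwap j) ∘ levelSwap j = x := by
  funext i; simp [levelSwap, Equiv.swap_apply_self]

omit [Fintype S] [DecidableEq S] in
/-- `y = x∘σ_j ↔ x = y∘σ_j`. [ours] -/
theorem eq_comp_levelSwap_comm (j : Fin K) (x y : Fin (K + 1) → S) : y = x ∘ levelSwap j ↔ x = y ∘ levelSwap j := by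
  constructor
  · intro h; rw [h, comp_levelSwap_levelSwap]
  · intro h; rw [h, comp_levelSwap_levelSwap]

omit [Fintype S] in
/-- The proposal is symmetric. [ours] -/
theorem ptBareProposal_symm (x y : Fin (K + 1) → S) : ptBareProposal x y = ptBareProposal y x := by
  unfold ptBareProposal
  exact sum_congr rfl fun j _ => by rw [if_congr (eq_comp_levelSwap_comm j x y) rfl rfl]

omit [Fintype S] in
/-- The proposal is non-negative. [ours] -/
theorem ptBareProposal_nonneg (x y : Fin (K + 1) → S) : 0 ≤ ptBareProposal x y :=
  sum_nonneg fun j _ => by split_ifs <;> positivity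

/-- The proposal has row mass `≤ 1`. [ours] -/
theorem sum_ptBareProposal_le_one (x : Fin (K + 1) → S) : ∑ y, ptBareProposal x y ≤ 1 := by
  unfold ptBareProposal
  rw [Finset.sum_comm]
  simp_rw [Finset.sum_ite_eq' univ, if_pos (mem_univ _)]
  rw [Finset.sum_const, Finset.card_univ, Fintype.card_fin, nsmul_eq_mul]
  rcases Nat.eq_zero_or_pos K with h | h
  · subst h; simp
  · rw [mul_one_div_cancel (by exact_mod_cast h.ne')]

omit [Fintype S] in
/-- Each adjacent transposition is proposed with weight at least `1/K`. [ours] -/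
theorem ptBareProposal_swap_ge (j : Fin K) (x : Fin (K + 1) → S) :
    (1 : ℝ) / K ≤ ptBareProposal x (x ∘ levelSwap j) := by
  unfold ptBareProposal
  calc (1 : ℝ) / K = (if x ∘ levelSwap j = x ∘ levelSwap j then (1 : ℝ) / K else 0) := by rw [if_pos rfl]
    _ ≤ ∑ i : Fin K, (if x ∘ levelSwap j = x ∘ levelSwap i then (1 : ℝ) / K else 0) :=
      Finset.single_le_sum (f := fun i : Fin K => if x ∘ levelSwap j = x ∘ levelSwap i then (1 : ℝ) / K else 0)
        (fun i _ => by split_ifs <;> positivity) (mem_univ j)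

/-- THE METROPOLIS SWAP MOVE on replica configurations: `mhKernel` of the swap proposal for the product law. [ours] -/
def ptBareSwap (μ : Fin (K + 1) → S → ℝ) : Matrix (Fin (K + 1) → S) (Fin (K + 1) → S) ℝ :=
  mhKernel ptBareProposal (tensorFun μ)

/-- THE TAGLESS REPLICA-EXCHANGE SAMPLER: with probability `t` a Metropolis swap of a uniformly chosen adjacent pair,
with probability `1 − t` an update of a uniformly chosen replica with its own kernel `M_k`. [ours] -/
def ptBareSampler (t : ℝ) (μ : Fin (K + 1) → S → ℝ) (M : Fin (K + 1) → S → S → ℝ) :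
    Matrix (Fin (K + 1) → S) (Fin (K + 1) → S) ℝ :=
  Matrix.of fun x y => t * ptBareSwap μ x y + (1 - t) * prodKernel (fun _ : Fin (K + 1) => (1 : ℝ) / (K + 1)) M x y

section Basic

variable {μ : Fin (K + 1) → S → ℝ} {M : Fin (K + 1) → S → S → ℝ} {t : ℝ}

/-- The swap move is in detailed balance with the product law. [ours] -/
theorem ptBareSwap_detailedBalance (hμ : ∀ k x, 0 < μ k x) : DetailedBalance (tensorFun μ) (ptBareSwap μ) :=
  mhKernel_detailedBalance (tensorFun_pos hμ) _

/-- The swap move is a transition matrix. [ours] -/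
theorem ptBareSwap_isRowStochastic (hμ : ∀ k x, 0 < μ k x) : IsRowStochastic (ptBareSwap μ) :=
  ⟨mhKernel_nonneg ptBareProposal_nonneg sum_ptBareProposal_le_one (tensorFun_pos hμ), mhKernel_sum_eq_one _ _⟩

/-- Off the diagonal, `π̃(x)·Sw(x,y) = T(x,y)·min{π̃(x), π̃(y)}`. [ours] -/
theorem tensorFun_mul_ptBareSwap (hμ : ∀ k x, 0 < μ k x) {x y : Fin (K + 1) → S} (hyx : y ≠ x) :
    tensorFun μ x * ptBareSwap μ x y = ptBareProposal x y * min (tensorFun μ x) (tensorFun μ y) := by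
  unfold ptBareSwap
  rw [mhKernel_of_ne hyx, mul_mhRate (tensorFun_pos hμ), ptBareProposal_symm y x,
    ← min_mul_of_nonneg _ _ (ptBareProposal_nonneg x y), mul_comm]

/-- Entries of the sampler. [ours] -/
theorem ptBareSampler_apply (t : ℝ) (μ : Fin (K + 1) → S → ℝ) (M : Fin (K + 1) → S → S → ℝ)
    (x y : Fin (K + 1) → S) :
    ptBareSampler t μ M x y
      = t * ptBareSwap μ x y + (1 - t) * prodKernel (fun _ : Fin (K + 1) => (1 : ℝ) / (K + 1)) M x y := rfl

/-- The uniform weights are a probability vector. [ours] -/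
theorem sum_uniform_weight (K : ℕ) : ∑ _k : Fin (K + 1), (1 : ℝ) / (K + 1) = 1 := by
  rw [Finset.sum_const, Finset.card_univ, Fintype.card_fin, nsmul_eq_mul]; push_cast; field_simp

/-- The sampler is a transition matrix (`0 ≤ t ≤ 1`, `M_k` row-stochastic). [ours] -/
theorem ptBareSampler_isRowStochastic (hμ : ∀ k x, 0 < μ k x) (hM : ∀ k, IsRowStochastic (M k))
    (ht0 : 0 ≤ t) (ht1 : t ≤ 1) : IsRowStochastic (ptBareSampler t μ M) := by
  have hU := prodKernel_isRowStochastic M (fun _ : Fin (K + 1) => (1 : ℝ) / (K + 1)) (fun _ => by positivity)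
    (sum_uniform_weight K) hM
  refine ⟨fun x y => ?_, fun x => ?_⟩
  · rw [ptBareSampler_apply]
    exact add_nonneg (mul_nonneg ht0 ((ptBareSwap_isRowStochastic hμ).1 x y))
      (mul_nonneg (by linarith) (hU.1 x y))
  · simp_rw [ptBareSampler_apply]
    rw [Finset.sum_add_distrib, ← Finset.mul_sum, ← Finset.mul_sum, (ptBareSwap_isRowStochastic hμ).2 x, hU.2 x]
    ring

/-- The sampler has non-negative entries (`0 ≤ t ≤ 1`). [ours] -/
theorem ptBareSampler_nonneg (hμ : ∀ k x, 0 < μ k x) (hM : ∀ k, IsRowStochastic (M k)) (ht0 : 0 ≤ t)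
    (ht1 : t ≤ 1) (x y : Fin (K + 1) → S) : 0 ≤ ptBareSampler t μ M x y :=
  (ptBareSampler_isRowStochastic hμ hM ht0 ht1).1 x y

omit [Fintype S] in
/-- **The sampler is in DETAILED BALANCE with the product law** (`M_k` in detailed balance with `μ_k`). [ours] -/
theorem ptBareSampler_detailedBalance [Fintype S] (hμ : ∀ k x, 0 < μ k x)
    (hMrev : ∀ k, DetailedBalance (μ k) (M k)) :
    DetailedBalance (tensorFun μ) (ptBareSampler t μ M) := by
  intro x y
  rw [ptBareSampler_apply, ptBareSampler_apply]
  have h1 := ptBareSwap_detailedBalance hμ x y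
  have h2 := prodKernel_detailedBalance hMrev (fun _ : Fin (K + 1) => (1 : ℝ) / (K + 1)) x y
  calc tensorFun μ x * (t * ptBareSwap μ x y + (1 - t) * prodKernel (fun _ => (1 : ℝ) / (K + 1)) M x y)
      = t * (tensorFun μ x * ptBareSwap μ x y)
        + (1 - t) * (tensorFun μ x * prodKernel (fun _ => (1 : ℝ) / (K + 1)) M x y) := by ring
    _ = t * (tensorFun μ y * ptBareSwap μ y x)
        + (1 - t) * (tensorFun μ y * prodKernel (fun _ => (1 : ℝ) / (K + 1)) M y x) := by rw [h1, h2]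
    _ = tensorFun μ y * (t * ptBareSwap μ y x + (1 - t) * prodKernel (fun _ => (1 : ℝ) / (K + 1)) M y x) := by
        ring

/-- The product law is stationary for the sampler. [ours] -/
theorem ptBareSampler_isStationary (hμ : ∀ k x, 0 < μ k x) (hM : ∀ k, IsRowStochastic (M k))
    (hMrev : ∀ k, DetailedBalance (μ k) (M k)) (ht0 : 0 ≤ t) (ht1 : t ≤ 1) :
    IsStationary (tensorFun μ) (ptBareSampler t μ M) :=
  (ptBareSampler_detailedBalance hμ hMrev).isStationary (ptBareSampler_isRowStochastic hμ hM ht0 ht1).2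

/-! ## §2 The two flow formulas -/

/-- **Swap flows:** `π̃(x)·P(x, x∘σ_j) ≥ (t/K)·min{π̃(x), π̃(x∘σ_j)}` (`0 ≤ t ≤ 1`). [ours] -/
theorem tensorFun_mul_ptBareSampler_swap_ge (hμ : ∀ k x, 0 < μ k x) (hM : ∀ k, IsRowStochastic (M k))
    (ht0 : 0 ≤ t) (ht1 : t ≤ 1) (x : Fin (K + 1) → S) (j : Fin K) :
    t / K * min (tensorFun μ x) (tensorFun μ (x ∘ levelSwap j))
      ≤ tensorFun μ x * ptBareSampler t μ M x (x ∘ levelSwap j) := by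
  have hU := prodKernel_isRowStochastic M (fun _ : Fin (K + 1) => (1 : ℝ) / (K + 1)) (fun _ => by positivity)
    (sum_uniform_weight K) hM
  by_cases hx : x ∘ levelSwap j = x
  · -- a proposal that does not move: the diagonal entry is at least `t·T(x,x) ≥ t/K`
    rw [hx, min_self]
    have hdiag : (1 : ℝ) / K ≤ ptBareSwap μ x x := by
      unfold ptBareSwap mhKernel
      rw [if_pos rfl]
      have hoff : ∑ y ∈ univ.erase x, mhRate ptBareProposal (tensorFun μ) x y ≤ ∑ y ∈ univ.erase x, ptBareProposal x y :=
        sum_le_sum fun y _ => mhRate_le _ _ _ _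
      have hrow : ∑ y ∈ univ.erase x, ptBareProposal x y + ptBareProposal x x ≤ 1 := by
        rw [Finset.sum_erase_add _ _ (mem_univ x)]; exact sum_ptBareProposal_le_one x
      have hxx : (1 : ℝ) / K ≤ ptBareProposal x x := by
        have h := ptBareProposal_swap_ge j x
        rwa [hx] at h
      linarith
    calc t / K * tensorFun μ x = tensorFun μ x * (t * (1 / K)) := by ring
      _ ≤ tensorFun μ x * (t * ptBareSwap μ x x) :=
          mul_le_mul_of_nonneg_left (mul_le_mul_of_nonneg_left hdiag ht0) (tensorFun_pos hμ x).le
      _ ≤ tensorFun μ x * ptBareSampler t μ M x x := by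
          rw [ptBareSampler_apply]
          refine mul_le_mul_of_nonneg_left ?_ (tensorFun_pos hμ x).le
          have : 0 ≤ (1 - t) * prodKernel (fun _ : Fin (K + 1) => (1 : ℝ) / (K + 1)) M x x :=
            mul_nonneg (by linarith) (hU.1 x x)
          linarith
  · rw [ptBareSampler_apply, mul_add, ← mul_assoc, mul_comm (tensorFun μ x) t, mul_assoc,
      tensorFun_mul_ptBareSwap hμ hx]
    have hT := ptBareProposal_swap_ge j x
    have hmin : 0 ≤ min (tensorFun μ x) (tensorFun μ (x ∘ levelSwap j)) :=
      le_min (tensorFun_pos hμ _).le (tensorFun_pos hμ _).le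
    have hupd : 0 ≤ tensorFun μ x * ((1 - t) * prodKernel (fun _ : Fin (K + 1) => (1 : ℝ) / (K + 1)) M x
        (x ∘ levelSwap j)) := mul_nonneg (tensorFun_pos hμ x).le (mul_nonneg (by linarith) (hU.1 _ _))
    calc t / K * min (tensorFun μ x) (tensorFun μ (x ∘ levelSwap j))
        = t * ((1 / K) * min (tensorFun μ x) (tensorFun μ (x ∘ levelSwap j))) := by ring
      _ ≤ t * (ptBareProposal x (x ∘ levelSwap j) * min (tensorFun μ x) (tensorFun μ (x ∘ levelSwap j))) :=
          mul_le_mul_of_nonneg_left (mul_le_mul_of_nonneg_right hT hmin) ht0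
      _ ≤ t * (ptBareProposal x (x ∘ levelSwap j) * min (tensorFun μ x) (tensorFun μ (x ∘ levelSwap j)))
          + tensorFun μ x * ((1 - t) * prodKernel (fun _ : Fin (K + 1) => (1 : ℝ) / (K + 1)) M x
            (x ∘ levelSwap j)) := le_add_of_nonneg_right hupd

/-- **Update entries:** the sampler dominates the slowed product chain entrywise,
`P(x, y) ≥ (1 − t)·prodKernel(x, y)` (`0 ≤ t`). [ours] -/
theorem ptBareSampler_ge_update (hμ : ∀ k x, 0 < μ k x) (ht0 : 0 ≤ t) (x y : Fin (K + 1) → S) :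
    (1 - t) * prodKernel (fun _ : Fin (K + 1) => (1 : ℝ) / (K + 1)) M x y ≤ ptBareSampler t μ M x y := by
  rw [ptBareSampler_apply]
  have : 0 ≤ t * ptBareSwap μ x y := mul_nonneg ht0 ((ptBareSwap_isRowStochastic hμ).1 x y)
  linarith

omit [Fintype S] in
/-- The product chain's entry at a one-coordinate move: for `v ≠ x k`,
`prodKernel w M x (update x k v) = w_k·M_k(x_k, v)`. [ours] -/
theorem prodKernel_update_of_ne [Fintype S] (w : Fin (K + 1) → ℝ) (M : Fin (K + 1) → S → S → ℝ)
    (x : Fin (K + 1) → S) (k : Fin (K + 1)) {v : S} (hv : v ≠ x k) :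
    prodKernel w M x (update x k v) = w k * M k (x k) v := by
  rw [prodKernel_apply, Finset.sum_eq_single k]
  · unfold coordKernel
    rw [update_self, if_pos]
    rfl
  · intro i _ hik
    unfold coordKernel
    rw [if_neg]
    · ring
    · intro h
      have e := congrFun h k
      rw [update_self, update_of_ne (Ne.symm hik)] at e
      exact hv e
  · intro h; exact absurd (mem_univ k) h

/-- **Update flows at one level:** for `v ≠ x_k`,
`π̃(x)·P(x, update x k v) ≥ ((1 − t)/(K+1))·π̃(x)·M_k(x_k, v)`. [ours] -/
theorem tensorFun_mul_ptBareSampler_update_ge (hμ : ∀ k x, 0 < μ k x) (ht0 : 0 ≤ t) (x : Fin (K + 1) → S)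
    (k : Fin (K + 1)) {v : S} (hv : v ≠ x k) :
    (1 - t) / (K + 1) * (tensorFun μ x * M k (x k) v)
      ≤ tensorFun μ x * ptBareSampler t μ M x (update x k v) := by
  have h := ptBareSampler_ge_update (M := M) hμ ht0 x (update x k v)
  rw [prodKernel_update_of_ne _ M x k hv] at h
  calc (1 - t) / (K + 1) * (tensorFun μ x * M k (x k) v)
      = tensorFun μ x * ((1 - t) * ((1 : ℝ) / (K + 1) * M k (x k) v)) := by ring
    _ ≤ tensorFun μ x * ptBareSampler t μ M x (update x k v) :=
        mul_le_mul_of_nonneg_left h (tensorFun_pos hμ x).le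

end Basic

end Summit.Ventures.LatticeQCDFlow.Scaling
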